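import Summits.HodgeConjecture.HodgeConjecture.Theses.HeightMassDefect
import Summits.HodgeConjecture.HodgeConjecture.Theorems.LinearSystemTorelliMiddleDivisorSupportFourfoldThreefoldDetection
import Summits.HodgeConjecture.HodgeConjecture.Theorems.LinearSystemTorelliMiddleDivisorSupportFourfoldPairingSplit
import Summits.HodgeConjecture.HodgeConjecture.Theorems.LinearSystemTorelliHardLefschetzReduction
import Summits.HodgeConjecture.HodgeConjecture.Theorems.HeightMassDefectSectionRestrictionSurface
import Literature.AlgebraicGeometry.HodgeTheory.HardLefschetzHodgeRiemannHolds
import Literature.AlgebraicGeometry.HodgeTheory.LefschetzOneOneHolds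
import Literature.AlgebraicGeometry.HodgeTheory.GysinKernelSplitHolds
import Literature.AlgebraicGeometry.HodgeTheory.GysinFormalismPushforward
import HarnessLib

/-!
# Route HeightMassDefect — support item `FourfoldCriterion` (stmt-HodgeConjecture-2516), PROVED

`FourfoldCriterion : SectionRestrictionFourfold → ∀ X smooth projective fourfold, HodgeConjectureFor 4 X`
(Brosnan–Fang–Nie–Pearlstein 2009, §6 with `n = 2`; Thomas 2005, §3 Rem. 1 (Totaro's weight
argument); de Cataldo–Migliorini 2009, §4). The theorem `heightMassDefect_fourfoldCriterion_proof`
has literally the type of the route decl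
`Summit.HodgeConjecture.HodgeConjecture.Theses.HeightMassDefect.FourfoldCriterion`; together with the
landed converse `heightMassDefect_sectionRestrictionFourfold_of_hodgeFourfolds` it makes the landing pad
`SectionRestrictionFourfold` EQUIVALENT to the Hodge conjecture for all smooth projective fourfolds
(`heightMassDefect_sectionRestrictionFourfold_iff_hodgeFourfolds`).

Proof (every input a THEOREM of the tree; no named-fact hypothesis, no definition, no sorry).
Fix a smooth projective fourfold `X` and write `Alg² = supportedClasses X 4 2 = algebraicClasses X 2`.

1. ORTHOGONAL CLASSES DIE ON EVERY PROPER CLOSED SUBSET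
   (`heightMassDefect_restrict_eq_zero_of_forall_cupProduct_eq_zero`). Let `c` be a rational
   `(2,2)`-class with `c ∪ a = 0` for all `a ∈ Alg²`, and `Z ⊊ X` Zariski-closed. Desingularise the
   components of `Z` (`exists_family_iUnion_range_eq_of_isClosed`, Hironaka
   `Resolution.Hironaka1964_projective_holds`): `Z = ⋃ⱼ gⱼ(Yⱼ)` with `Yⱼ` smooth projective of dimension
   `≤ 3`. Then `gⱼ^* c = 0` for every `j`: for threefolds this is the tree's threefold step
   `threefoldDetection_map_eq_zero_of_forall_cupProduct_eq_zero` (fed with the theorems BFNP (6.1)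
   `hardLefschetz_hodgeRiemann_holds.hodgeClasses_cupPairing_nondegenerate` and Lefschetz `(1,1)` `lefschetzOneOne_rational_holds`);
   for surfaces (`heightMassDefect_map_eq_zero_of_forall_cupProduct_eq_zero_surface`) the same argument
   one degree down — were `g^* c ≠ 0 ∈ H⁴(Y(ℂ))`, (6.1) on the surface gives a rational `(0,0)` partner
   `s ∈ H⁰(Y(ℂ))` with `g^* c ∪ s ≠ 0`, but `g_* s ∈ Alg²(X)` (`complexGysin_mem_supportedClasses`), so
   `0 = c ∪ g_* s = g_*(g^* c ∪ s)` (projection formula `complexGysin_cup`) and the top-degree Gysin map is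
   injective (`stub_topGysinInjective`); curves and points have `H⁴ = 0`. Deligne's Hodge III Prop. 8.2.7
   (`Deligne1974_ker_pullback_eq_ker_pullback_resolution_holds`, a theorem of the tree) then makes `c`
   vanish on an open neighbourhood of `Z(ℂ)`, hence on `Z(ℂ)` by functoriality.
2. PARTNERS (`heightMassDefect_exists_cupProduct_ne_zero_of_sectionRestrictionFourfold`). Granted
   `SectionRestrictionFourfold`, a non-zero rational `(2,2)`-class `c` restricts non-trivially to some
   hypersurface section `Z = X ∩ V₊(F) ≠ X` for the projective embedding of `X`; by 1, `c` is not
   orthogonal to `Alg²`.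
3. PAIRING SPLIT: the landed `linearSystemTorelli_middleDivisorSupportFourfold_pairingSplit_of_deligne`
   (ℚ-dimension count, BFNP (6.1) sentence; fed with Deligne 8.2.8
   `Deligne1974_ker_restrictCompl_eq_iSup_range_complexGysin_holds`) turns 2 into `Hdg⁴(X) ⊆ Alg²(X)` —
   the Hodge conjecture for `X` in codimension `2` (`heightMassDefect_hc42_of_sectionRestrictionFourfold`).
4. BOOKKEEPING (`heightMassDefect_hodgeConjectureFor_four_of_codim_two`): codimension `0` is
   `hodgeConjectureFor_codim_zero`, codimension `1` is Lefschetz `(1,1)`, codimension `≥ 3` is the closed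
   item `HardLefschetzReduction` (`linearSystemTorelli_hardLefschetzReduction_proof`, from codimension
   `4 - p ≤ 1`), and the Hodge model is `nonempty_hodgeModel_holds`.

References: [BrosnanFangNiePearlstein2009] §6 (6.1), Lemma 48, Thm. 52; [Thomas2005Nodes] §3 Rem. 1;
[DecataldoMigliorini2009] §4; [DeligneHodgeIII1974] Prop. 8.2.7, Cor. 8.2.8; [VoisinHodgeI2002]
Thm. 6.25, Thm. 11.30; [KerrPearlstein2011] Thm. 42.
-/

noncomputable section

-- every declaration of this problem lives in `Summit.HodgeConjecture.HodgeConjecture.…` (summit = sub-problem)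
set_option linter.dupNamespace false

namespace Summit.HodgeConjecture.HodgeConjecture.Theorems

open CategoryTheory AlgebraicGeometry
open Literature.AlgebraicGeometry Literature.AlgebraicGeometry.Motives Literature.AlgebraicGeometry.HodgeTheory
open Literature.AlgebraicTopology.SingularHomology
open Summit.HodgeConjecture.HodgeConjecture.Theses.HeightMassDefect
  (SectionRestrictionFourfold FourfoldCriterion)

/-! ### Step 1: a rational `(2,2)`-class orthogonal to `Alg²` dies on every proper closed subset -/

/-- **The surface step** (de Cataldo–Migliorini §4 one degree down). Let `X` be a smooth projective
complex fourfold, `c ∈ H⁴(X(ℂ); ℂ)` a rational `(2,2)`-class cup-orthogonal to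
`Alg²(X) = supportedClasses X 4 2`, and `g : Y ⟶ X` a morphism from a smooth projective surface. Then
`g^* c = 0 ∈ H⁴(Y(ℂ); ℂ)`: otherwise BFNP (6.1) on `Y` (`k = 2`, `l = 0`, a theorem of the tree) gives a
rational `(0,0)`-class `s ∈ H⁰(Y(ℂ); ℂ)` with `g^* c ∪ s ≠ 0`; but `g_* s ∈ N²H⁴(X) = Alg²(X)`
(`complexGysin_mem_supportedClasses`, `H⁰ = N⁰H⁰`), so `0 = c ∪ g_* s = g_* (g^* c ∪ s)` (projection
formula), and the top-degree Gysin map `H⁴(Y(ℂ)) → H⁸(X(ℂ))` is injective (`stub_topGysinInjective`).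
[cite: DecataldoMigliorini2009, §4] [cite: BrosnanFangNiePearlstein2009, §6 (6.1)]
[cite: FultonYoungTableaux1997, Appendix B §B.1 (6)] -/
theorem heightMassDefect_map_eq_zero_of_forall_cupProduct_eq_zero_surface {Y X : SchemeOver ℂ}
    (hY : IsSmoothProjective 2 Y) (hX : IsSmoothProjective 4 X) (g : Y ⟶ X)
    {c : complexBetti X 4} (hc : IsRationalClass c) (hh : IsOfHodgeType 4 X 4 2 2 c)
    (hno : ∀ a ∈ supportedClasses X 4 2, cupProduct (rfl : (4:ℕ) + 4 = 4 + 4) c a = 0) :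
    complexBetti.map g 4 c = 0 := by
  -- an orientation family, with Poincaré duality
  let μ : OrientationFamily := fun _ _ h ↦ (ComplexPoints.isOrientableOver ℂ h).some
  have hμ : μ.HasPoincareDuality := μ.hasPoincareDuality
  -- `g^* c` is a rational `(2,2)`-class on the surface `Y`
  have htQ : IsRationalClass (complexBetti.map g 4 c) := hc.pullback _
  have htH : IsOfHodgeType 2 Y 4 2 2 (complexBetti.map g 4 c) :=
    hh.map_of_le hY hX (nonempty_hodgeModel_holds.nonempty hY).some g (by norm_num)
  by_contra hne
  -- BFNP (6.1) on `Y` (`k = 2`, `l = 0`): a rational `(0,0)` partner `s`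
  obtain ⟨s, hsQ, hsH, hts⟩ :=
    (hardLefschetz_hodgeRiemann_holds (d := 2) (X := Y)).hodgeClasses_cupPairing_nondegenerate hY 4
      (show (2:ℕ) + 0 = 2 from rfl) (show 2 * 2 + 2 * 0 = 4 by norm_num) _ htQ htH hne
  -- `g_* s ∈ Alg²(X)` (every class of `H⁰` is supported in codimension `0`)
  have hs0 : s ∈ supportedClasses Y (2 * 0) 0 := by
    rw [supportedClasses_zero]
    exact Submodule.mem_top
  have hgs : complexGysin μ hY hX g (show 2 * 0 + 2 * 4 = 4 + 2 * 2 by norm_num) s ∈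
      supportedClasses X 4 2 :=
    complexGysin_mem_supportedClasses (gysinMap_restrictCompl_eq_zero_of_field ℂ) μ hμ hY hX g _
      (r := 0) (s := 2) (by norm_num) hs0
  -- projection formula: `g_* (g^* c ∪ s) = c ∪ g_* s = 0`
  have h1 : complexGysin μ hY hX g (show 4 + 2 * 4 = 4 + 4 + 2 * 2 by norm_num)
      (cupProduct (show 4 + 2 * 0 = 4 by norm_num) (complexBetti.map g 4 c) s) = 0 := by
    rw [complexGysin_cup hμ hY hX g (show 4 + 2 * 0 = 4 by norm_num)
      (show 4 + 2 * 4 = 4 + 4 + 2 * 2 by norm_num) (show 2 * 0 + 2 * 4 = 4 + 2 * 2 by norm_num)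
      (rfl : (4:ℕ) + 4 = 4 + 4) c s]
    exact hno _ hgs
  -- the top-degree Gysin map `H⁴(Y(ℂ)) → H⁸(X(ℂ))` is injective
  exact hts (stub_topGysinInjective μ hμ hY hX g (show 4 + 2 * 4 = 4 + 4 + 2 * 2 by norm_num) rfl
    (h1.trans (map_zero _).symm))

/-- **Pull-backs to resolutions vanish.** For `X` a smooth projective fourfold, `c` a rational
`(2,2)`-class cup-orthogonal to `Alg²(X)`, and `g : Y ⟶ X` from a smooth projective `Y` of dimension
`m ≤ 3`: `g^* c = 0` (threefolds: the tree's threefold step, fed with the theorems (6.1) and Lefschetz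
`(1,1)`; surfaces: `heightMassDefect_map_eq_zero_of_forall_cupProduct_eq_zero_surface`; `m ≤ 1`:
`H⁴(Y(ℂ); ℂ) = 0`). [cite: DecataldoMigliorini2009, §4] [cite: BrosnanFangNiePearlstein2009, §6 (6.1)] -/
theorem heightMassDefect_map_eq_zero_of_forall_cupProduct_eq_zero {m : ℕ} {Y X : SchemeOver ℂ}
    (hY : IsSmoothProjective m Y) (hX : IsSmoothProjective 4 X) (g : Y ⟶ X) (hm : m + 1 ≤ 4)
    {c : complexBetti X 4} (hc : IsRationalClass c) (hh : IsOfHodgeType 4 X 4 2 2 c)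
    (hno : ∀ a ∈ supportedClasses X 4 2, cupProduct (rfl : (4:ℕ) + 4 = 4 + 4) c a = 0) :
    complexBetti.map g 4 c = 0 := by
  rcases Nat.lt_or_ge m 2 with h2 | h2
  · -- curves and points: `H⁴(Y(ℂ); ℂ) = 0`
    haveI := subsingleton_complexBetti hY (k := 4) (by omega)
    exact Subsingleton.elim _ _
  obtain rfl | rfl : m = 3 ∨ m = 2 := by omega
  · exact threefoldDetection_map_eq_zero_of_forall_cupProduct_eq_zero
      (fun Y ↦ (hardLefschetz_hodgeRiemann_holds (d := 3) (X := Y)).hodgeClasses_cupPairing_nondegenerate)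
      lefschetzOneOne_rational_holds hY hX g hc hh hno
  · exact heightMassDefect_map_eq_zero_of_forall_cupProduct_eq_zero_surface hY hX g hc hh hno

/-- **Step 1.** On a smooth projective complex fourfold `X`, a rational `(2,2)`-class `c` which is
cup-orthogonal to `Alg²(X) = supportedClasses X 4 2` restricts to zero on the complex points of EVERY
Zariski-closed `Z ≠ X`: desingularise the components of `Z` (Hironaka), kill the pull-backs to the
resolving varieties of dimension `≤ 3` (`heightMassDefect_map_eq_zero_of_forall_cupProduct_eq_zero`),
and descend with Deligne's Hodge III Prop. 8.2.7 (`Deligne1974_ker_pullback_eq_ker_pullback_resolution_holds`: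
a class killed by every `gⱼ^*` dies on an open neighbourhood of `Z(ℂ) = ⋃ gⱼ(Yⱼ)(ℂ)`), restricting
further to `Z(ℂ)` by functoriality. [cite: DeligneHodgeIII1974, Prop. 8.2.7 and Cor. 8.2.8]
[cite: Thomas2005Nodes, §3 Remark 1] [cite: BrosnanFangNiePearlstein2009, §6 proof of Thm. 52] -/
theorem heightMassDefect_restrict_eq_zero_of_forall_cupProduct_eq_zero {X : SchemeOver ℂ}
    (hX : IsSmoothProjective 4 X) {c : complexBetti X 4} (hc : IsRationalClass c)
    (hh : IsOfHodgeType 4 X 4 2 2 c)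
    (hno : ∀ a ∈ supportedClasses X 4 2, cupProduct (rfl : (4:ℕ) + 4 = 4 + 4) c a = 0)
    {Z : Set X.left} (hZ : IsClosed Z) (hZu : Z ≠ Set.univ) :
    singularCohomology.map ℂ ℂ
      (⟨Subtype.val, continuous_subtype_val⟩ : C({P : ComplexPoints X // P.pt ∈ Z}, ComplexPoints X))
      4 c = 0 := by
  -- points of the proper closed `Z` have codimension `≥ 1`
  have hcod : ∀ z ∈ Z, (1 : ℕ∞) ≤ Order.coheight z :=
    fun z hz ↦ one_le_coheight_of_mem_of_isClosed hX hZ hZu hz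
  -- desingularise the components of `Z` (Hironaka): `Z = ⋃ j, g_j(Y j)`, `dim Y j ≤ 3`
  obtain ⟨ι, hι, m, Y, hY, g, hZg, hm⟩ :=
    exists_family_iUnion_range_eq_of_isClosed Resolution.Hironaka1964_projective_holds hX hZ
      (r := 1) hcod
  haveI := hι
  -- every pull-back `g_j^* c` vanishes
  have hg : ∀ j, complexBetti.map (g j) 4 c = 0 :=
    fun j ↦ heightMassDefect_map_eq_zero_of_forall_cupProduct_eq_zero (hY j) hX (g j) (hm j) hc hh hno
  -- Deligne, Hodge III 8.2.7: `c` dies on an open neighbourhood `V` of `Z(ℂ)`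
  obtain ⟨V, -, hZV, hcV⟩ := Deligne1974_ker_pullback_eq_ker_pullback_resolution_holds hX hY g 4 c hg
  -- restrict further from `V` to `Z(ℂ)`
  have hsub : {P : ComplexPoints X | P.pt ∈ Z} ⊆ V := by
    intro P hP
    exact hZV (by simpa only [Set.mem_setOf_eq, hZg] using hP)
  have h0 : singularCohomology.map ℂ ℂ (subsetIncl {P : ComplexPoints X | P.pt ∈ Z}) 4 c = 0 := by
    rw [show subsetIncl {P : ComplexPoints X | P.pt ∈ Z} = (subsetIncl V).comp (subsetInclusion hsub)
      from rfl, singularCohomology.map_comp, ModuleCat.comp_apply, hcV, map_zero]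
  exact h0

/-! ### Step 2: granted `SectionRestrictionFourfold`, every non-zero Hodge class pairs with `Alg²` -/

/-- **Step 2.** Granted the landing pad `SectionRestrictionFourfold`, on a smooth projective fourfold
every non-zero rational `(2,2)`-class `c` has a partner `a ∈ Alg²(X) = supportedClasses X 4 2` with
`c ∪ a ≠ 0 ∈ H⁸(X(ℂ); ℂ)`: otherwise `c` would die on every proper closed subset (Step 1), in
particular on the hypersurface section `Z = X ∩ V₊(F) ≠ X` (for the projective embedding of `X`) on
which `SectionRestrictionFourfold` says it does not. [cite: BrosnanFangNiePearlstein2009, §6 Thm. 52]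
[cite: KerrPearlstein2011, Thm. 42] -/
theorem heightMassDefect_exists_cupProduct_ne_zero_of_sectionRestrictionFourfold
    (hSRF : SectionRestrictionFourfold) {X : SchemeOver ℂ} (hX : IsSmoothProjective 4 X)
    (c : complexBetti X 4) (hc : IsRationalClass c) (hh : IsOfHodgeType 4 X 4 2 2 c) (hne : c ≠ 0) :
    ∃ a ∈ supportedClasses X 4 2, cupProduct (rfl : (4:ℕ) + 4 = 4 + 4) c a ≠ 0 := by
  by_contra hno
  push Not at hno
  -- a projective embedding of `X` and the hypersurface section supplied by the landing pad
  let e : ProjectiveEmbedding X := hX.isProjectiveOver.projectiveEmbedding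
  obtain ⟨k, F, Z, -, -, hZ, hZu, hcZ⟩ := hSRF hX e c hc hh hne
  -- `Z` is Zariski-closed (preimage of a zero locus of the projective spectrum)
  have hZc : IsClosed Z := by
    letI := MvPolynomial.gradedAlgebra (σ := Fin (e.n + 1)) (R := ℂ)
    rw [hZ]
    exact (ProjectiveSpectrum.isClosed_zeroLocus _ _).preimage (Scheme.Hom.continuous _)
  exact hcZ (heightMassDefect_restrict_eq_zero_of_forall_cupProduct_eq_zero hX hc hh hno hZc hZu)

/-! ### Step 3: the Hodge conjecture for fourfolds in codimension two -/

/-- **Step 3 — `SectionRestrictionFourfold` ⟹ HC(4,2).** Granted the landing pad, every rational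
`(2,2)`-class on a smooth projective complex fourfold is algebraic
(`∈ algebraicClasses X 2 = supportedClasses X 4 2`): Step 2 feeds the landed pairing split
`linearSystemTorelli_middleDivisorSupportFourfold_pairingSplit_of_deligne` (the ℚ-dimension count of
BFNP §6; its one named-fact input, Deligne's Cor. 8.2.8, is the theorem
`Deligne1974_ker_restrictCompl_eq_iSup_range_complexGysin_holds`).
[cite: BrosnanFangNiePearlstein2009, §6 (6.1) and Lemma 48] [cite: DeligneHodgeIII1974, Cor. 8.2.8] -/
theorem heightMassDefect_hc42_of_sectionRestrictionFourfold (hSRF : SectionRestrictionFourfold)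
    {X : SchemeOver ℂ} (hX : IsSmoothProjective 4 X) (c : complexBetti X 4) (hc : IsRationalClass c)
    (hh : IsOfHodgeType 4 X 4 2 2 c) : c ∈ algebraicClasses X 2 :=
  linearSystemTorelli_middleDivisorSupportFourfold_pairingSplit_of_deligne
    Deligne1974_ker_restrictCompl_eq_iSup_range_complexGysin_holds hX
    (fun c hc hh hne ↦
      heightMassDefect_exists_cupProduct_ne_zero_of_sectionRestrictionFourfold hSRF hX c hc hh hne)
    c hc hh

/-! ### Step 4: bookkeeping in the other codimensions -/

/-- **Step 4 — HC(4,2) for `X` gives `HodgeConjectureFor 4 X`.** Codimension `0`: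
`hodgeConjectureFor_codim_zero`; codimension `1`: Lefschetz `(1,1)` (`lefschetzOneOne_rational_holds`);
codimension `2`: the hypothesis; codimension `p ≥ 3`: the closed item `HardLefschetzReduction`
(`linearSystemTorelli_hardLefschetzReduction_proof`, from codimension `4 - p ≤ 1`); Hodge model:
`nonempty_hodgeModel_holds`. [cite: VoisinHodgeI2002, Thm. 6.25, Rem. 6.27 and Thm. 11.30]
[cite: Deligne2000, §1] -/
theorem heightMassDefect_hodgeConjectureFor_four_of_codim_two {X : SchemeOver ℂ}
    (hX : IsSmoothProjective 4 X)
    (h42 : ∀ c : complexBetti X 4, IsRationalClass c → IsOfHodgeType 4 X 4 2 2 c →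
      c ∈ algebraicClasses X 2) :
    HodgeConjectureFor 4 X := by
  refine ⟨nonempty_hodgeModel_holds.nonempty hX, fun p c hc hpp ↦ ?_⟩
  -- codimension `q ≤ 1`: the tree (`q = 0`) and Lefschetz `(1,1)` (`q = 1`)
  have low : ∀ q, q ≤ 1 → ∀ a : complexBetti X (2 * q), IsRationalClass a →
      IsOfHodgeType 4 X (2 * q) q q a → a ∈ algebraicClasses X q := by
    intro q hq a ha haa
    rcases q with _ | _ | q
    · exact hodgeConjectureFor_codim_zero a
    · exact lefschetzOneOne_rational_holds hX a ha haa
    · omega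
  rcases Nat.lt_or_ge 2 p with hp | hp
  · -- codimension `p ≥ 3`: the hard-Lefschetz reduction from codimension `4 - p ≤ 1`
    exact linearSystemTorelli_hardLefschetzReduction_proof 4 p (by omega) hX
      (low (4 - p) (by omega)) c hc hpp
  · rcases Nat.lt_or_ge 1 p with hp1 | hp1
    · -- codimension `2`
      obtain rfl : p = 2 := le_antisymm hp hp1
      exact h42 c hc hpp
    · exact low p hp1 c hc hpp

/-! ### The item -/

/-- **Item stmt-HodgeConjecture-2516 (`FourfoldCriterion`, route `HeightMassDefect`), PROVED**
(Brosnan–Fang–Nie–Pearlstein 2009, §6, `n = 2`; Thomas 2005, §3 Rem. 1): if every non-zero rational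
`(2,2)`-class on every smooth projective complex fourfold restricts non-trivially to some hypersurface
section (`SectionRestrictionFourfold`), then the Hodge conjecture holds for every smooth projective
complex fourfold. The type is literally the route decl
`Summit.HodgeConjecture.HodgeConjecture.Theses.HeightMassDefect.FourfoldCriterion`.
[cite: BrosnanFangNiePearlstein2009, §6 (6.1), Lemma 48 and Thm. 52] [cite: Thomas2005Nodes, §3 Remark 1]
[cite: DecataldoMigliorini2009, §4] [cite: DeligneHodgeIII1974, Prop. 8.2.7 and Cor. 8.2.8] -/
theorem heightMassDefect_fourfoldCriterion_proof : FourfoldCriterion := by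
  intro hSRF X hX
  exact heightMassDefect_hodgeConjectureFor_four_of_codim_two hX
    (heightMassDefect_hc42_of_sectionRestrictionFourfold hSRF hX)

/-- **`SectionRestrictionFourfold` ⟺ the Hodge conjecture for all smooth projective fourfolds**
(Kerr–Pearlstein 2011 Thm. 42 / BFNP 2009 Thm. 52 at `2n = 4`, both directions now theorems of the
tree: `heightMassDefect_fourfoldCriterion_proof` and the landed
`heightMassDefect_sectionRestrictionFourfold_of_hodgeFourfolds`).
[cite: KerrPearlstein2011, Conj. 41 and Thm. 42] [cite: BrosnanFangNiePearlstein2009, §6 Thm. 52] -/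
theorem heightMassDefect_sectionRestrictionFourfold_iff_hodgeFourfolds :
    SectionRestrictionFourfold ↔
      ∀ ⦃X : SchemeOver ℂ⦄, IsSmoothProjective 4 X → HodgeConjectureFor 4 X :=
  ⟨fun h _ hX ↦ heightMassDefect_fourfoldCriterion_proof h hX,
    heightMassDefect_sectionRestrictionFourfold_of_hodgeFourfolds⟩

end Summit.HodgeConjecture.HodgeConjecture.Theorems

end
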